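/-
Copyright (c) 2026 the pub-hodgecm-mathlib formalisation cell (harness21).  Prover seat hodgecm-mathlib-K2Liu-p12 (g5), Track B «K2-LIT»,
#184♮ = hLiu418 = `stmt-HodgeConjecture-24832`; socket #41 open surface (u-0c), file I4 EDITION 4 (K2E4-p11 (g8)): the letter `hΛ1` of ★ p862505
`K2LiuSiegelMiddleTermLevelLetters.exists_level_letters` DISCHARGED for the chart's Levi homomorphism (LEAD F0P6-plan (g14) BATCH #66 (2)).
THEOREMS ONLY (no `def`, no `instance`, no `notation`, no named-fact hypothesis, no `sorry`).
-/
import Summits.HodgeConjecture.HodgeConjecture.Theorems.K2LiuSiegelMiddleTermLevelLetters   -- ★ p862505 (this seat): `exists_level_letters` (takes `hΛ1` by value)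
import Summits.HodgeConjecture.HodgeConjecture.Theorems.K2LiuSiegelDoubledLeviMatrix         -- ★ `isUnit_det_gramRA`, `exists_leviHom` (the chart's `Λ`, `hΛ`)
import HarnessLib

/-!
# Crux `HLiu418`, socket #41, (u-0c) FILE I4 ED. 4 — `K2LiuSiegelLeviArchPart`: THE LEVI CHART KILLS THE ARCHIMEDEAN COMPONENT OF `GL_n(𝔸_L^∞)`;
# the level letters of I4 ED. 4 over the chart letter `hΛ` (no `hΛ1`)

Cell `hodgecm-mathlib`, crux item hLiu418 = `stmt-HodgeConjecture-24832`; squad K2 ∕ K2Liu, road `K2_Liu`, socket #41; LEAD F0P6-plan (g14) BATCH #65 (2), #66 (2).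
Lane `--supports stmt-HodgeConjecture-24832 --as helper` (count-neutral helper; closes no socket by itself).

★ p862505 `exists_level_letters` produces the level letters `S γl hγ0 hγ1 hχlev U hUK hfU hΛU` of K2E4-p11's I4 ED. 4
(`K2LiuSiegelEisensteinMiddleTermOfStandard.exists_middleTerm_package_of_standard`, 📤 p862508) from ONE letter on the Levi homomorphism `Λ : GL_n(𝔸_L) →* H(𝔸)`:
`hΛ1 : (Λ (1, r))_∞ = 1`.  THIS FILE pays `hΛ1` from the chart letter `hΛ` of record (★ `K2LiuSiegelDoubledLeviMatrix.exists_leviHom`,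
`blk (Λ g) = R · [[g, 0], [0, T⁻¹ σ(g⁻¹)ᵀ T]] · R⁻¹`): for `g = (1, r) = GLn.ofFinite r` the archimedean components of the entries of `g` and of `σ(g⁻¹)` are those of the
identity (★ `GLn.coe_ofFinite_apply`; `σ = c ⊗ 1` acts componentwise, ★ `AdeleRing.smul_fst`), so the archimedean component of `[[g,0],[0,T⁻¹σ(g⁻¹)ᵀT]]` is
`[[1,0],[0,T⁻¹T]] = 1` and that of `blk (Λ g)` is `(R R⁻¹)_∞ = 1` (★ `cayR_mul_cayRinv`); hence `GLn.fstHom (Λ g) = 1`, `GLn.toMixed (Λ g) = 1`, `archPart (Λ g) = 1`.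
* §1 **`archPart_eq_one_of_blk_eq_levi`** — `archPart q = 1` for any `q ∈ H(𝔸)` whose `blk` is the Levi matrix of `(1, r)`;
* §2 **`exists_level_letters_of_blk`** — ★ `exists_level_letters` with `hΛ1` replaced by the chart letter `hΛ` (the consumer's own binder): USE
  `obtain ⟨S₇, γl, hγ0, hγ1, hχlev, U, hUK, hfU, hΛU⟩ := exists_level_letters_of_blk L e dV hdV dW hdW hdV0 hdW0 h𝒦 (f s₀) (hstd.2.1 s₀) (hcont s₀) χ Λ hΛ hΛc`.
[cite: HarrisKudlaSweet1996, §1 (1.11)] [cite: BorelJacquet1979, §4.1] [cite: PlatonovRapinchuk1994, §5.1]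
HONEST LABEL.  Count-neutral helper; it retires nothing by itself: `HC_CM` is proved only modulo the 7 printed citations (2 remaining named inputs:
hLiu418 = `stmt-HodgeConjecture-24832`, h413 = `stmt-HodgeConjecture-24833`) until rung 0 closes.

## References
* [HarrisKudlaSweet1996] M. Harris, S. S. Kudla, W. J. Sweet, J. Amer. Math. Soc. 9 (1996), §1 (1.11) (the Siegel Levi `m(a) = (a, ǎ)`).
* [BorelJacquet1979] A. Borel, H. Jacquet, PSPM 33.1 (1979), §4.1 (`g = g_∞ g_f`).
* [PlatonovRapinchuk1994] V. Platonov, A. Rapinchuk, *Algebraic Groups and Number Theory* (1994), §5.1.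
-/

set_option autoImplicit false
set_option linter.dupNamespace false -- the mandated namespace repeats `HodgeConjecture.HodgeConjecture`

noncomputable section

open scoped Matrix Topology
open NumberField IsDedekindDomain ValuativeRel
open Literature.NumberTheory.Automorphic Literature.NumberTheory.GaloisRepresentations
open Literature.NumberTheory.GelbartRogawski1991 Literature.NumberTheory.GelbartRogawski1991.GRConstruction
open Literature.NumberTheory.GelbartRogawski1991.AdaptedBlocks
open Literature.NumberTheory.K2Lit.SiegelDoubled
open Summit.HodgeConjecture.HodgeConjecture.Cruxes.HLiu418.K2LiuSiegelDoubledLeviMatrix (isUnit_det_gramRA)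
open Summit.HodgeConjecture.HodgeConjecture.Cruxes.HLiu418.K2LiuSiegelMiddleTermLevelLetters (exists_level_letters)

namespace Summit.HodgeConjecture.HodgeConjecture.Cruxes.HLiu418.K2LiuSiegelLeviArchPart

/-! ## §1 `archPart` of a Levi element over `(1, r)` is trivial -/

section Levi

variable (L : Type) [Field L] [NumberField L] [IsCMField L]
variable {N M n : ℕ} (e : Fin N × Fin M ≃ Fin n)
  (dV : Fin N → L) (hdV : ∀ i, IsCMField.complexConj L (dV i) = dV i)
  (dW : Fin M → L) (hdW : ∀ i, IsCMField.complexConj L (dW i) = dW i)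

/-- **THE LEVI CHART KILLS THE ARCHIMEDEAN COMPONENT OF `GL_n(𝔸_L^∞)`**: if `blk q = R · [[g, 0], [0, T⁻¹ σ(g⁻¹)ᵀ T]] · R⁻¹` with `g = (1, r) = GLn.ofFinite r`
(the Levi matrix of ★ `exists_leviHom` at `g`), then `archPart q = 1` in `H_∞` — the archimedean component of `blk q` is `R · [[1, 0], [0, T⁻¹ T]] · R⁻¹ = 1`
(★ `GLn.coe_ofFinite_apply`, ★ `AdeleRing.smul_fst`, ★ `isUnit_det_gramRA`, ★ `cayR_mul_cayRinv`), hence `GLn.fstHom q = 1` and `GLn.toMixed q = 1`. [cite: HarrisKudlaSweet1996, §1 (1.11)] [cite: BorelJacquet1979, §4.1] -/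
theorem archPart_eq_one_of_blk_eq_levi (hdV0 : ∀ i, dV i ≠ 0) (hdW0 : ∀ i, dW i ≠ 0) {q : HA L e dV hdV dW hdW} (r : GL (Fin n) (FiniteAdeleRing (𝓞 L) L))
    (hq : blk L e dV hdV dW hdW q =
      cayR (AdeleRing (𝓞 L) L) (Fin n) * Matrix.fromBlocks ((GLn.ofFinite n L r : GL (Fin n) (AdeleRing (𝓞 L) L)) : Matrix (Fin n) (Fin n) (AdeleRing (𝓞 L) L)) 0 0
        (((gramR L e dV hdV dW hdW).map ((algebraMap L (AdeleRing (𝓞 L) L)).comp (algebraMap (Fp L) L)))⁻¹ *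
          ((((GLn.ofFinite n L r)⁻¹ : GL (Fin n) (AdeleRing (𝓞 L) L)) : Matrix (Fin n) (Fin n) (AdeleRing (𝓞 L) L)).map
            (UnitaryGroup.conjAdele (Fp L) L (IsCMField.complexConj L)))ᵀ *
          (gramR L e dV hdV dW hdW).map ((algebraMap L (AdeleRing (𝓞 L) L)).comp (algebraMap (Fp L) L))) *
        cayRinv (AdeleRing (𝓞 L) L) (Fin n)) :
    UnitaryGroup.archPart (Fp L) L (IsCMField.complexConj L) (n + n) (hermD L e dV hdV dW hdW) q = 1 := by
  -- the archimedean component `x ↦ x_∞` as a ring homomorphism on `𝔸_L` (kept opaque)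
  obtain ⟨f, hf⟩ : ∃ f : AdeleRing (𝓞 L) L →+* InfiniteAdeleRing L, ∀ x, f x = x.1 := ⟨RingHom.fst _ _, fun _ => rfl⟩
  have hf0 : f 0 = 0 := map_zero f
  have hf1 : f 1 = 1 := map_one f
  have hT := isUnit_det_gramRA L e dV hdV dW hdW hdV0 hdW0
  -- the entries of `(1, r)` and of `σ((1, r)⁻¹)` have the archimedean components of the identity (★ `GLn.coe_ofFinite_apply`, ★ `AdeleRing.smul_fst`)
  have hg : ((GLn.ofFinite n L r : GL (Fin n) (AdeleRing (𝓞 L) L)) : Matrix (Fin n) (Fin n) (AdeleRing (𝓞 L) L)).map f = 1 := by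
    ext i j
    rw [Matrix.map_apply, hf, GLn.coe_ofFinite_apply]
  have hmid : ((((GLn.ofFinite n L r)⁻¹ : GL (Fin n) (AdeleRing (𝓞 L) L)) : Matrix (Fin n) (Fin n) (AdeleRing (𝓞 L) L)).map
      (UnitaryGroup.conjAdele (Fp L) L (IsCMField.complexConj L))).map f = 1 := by
    rw [← map_inv]
    ext i j
    simp only [Matrix.map_apply, hf, GLn.coe_ofFinite_apply, UnitaryGroup.conjAdele_apply, AdeleRing.smul_fst, Matrix.one_apply]
    split_ifs
    · exact smul_one _
    · exact smul_zero _
  have hD : (((gramR L e dV hdV dW hdW).map ((algebraMap L (AdeleRing (𝓞 L) L)).comp (algebraMap (Fp L) L)))⁻¹ *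
      ((((GLn.ofFinite n L r)⁻¹ : GL (Fin n) (AdeleRing (𝓞 L) L)) : Matrix (Fin n) (Fin n) (AdeleRing (𝓞 L) L)).map
        (UnitaryGroup.conjAdele (Fp L) L (IsCMField.complexConj L)))ᵀ *
      (gramR L e dV hdV dW hdW).map ((algebraMap L (AdeleRing (𝓞 L) L)).comp (algebraMap (Fp L) L))).map f = 1 := by
    rw [Matrix.map_mul, Matrix.map_mul, Matrix.transpose_map, hmid, Matrix.transpose_one, Matrix.mul_one, ← Matrix.map_mul,
      Matrix.nonsing_inv_mul _ hT, Matrix.map_one f hf0 hf1]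
  -- the Levi block matrix and `blk q` have trivial archimedean component
  have hX : (Matrix.fromBlocks ((GLn.ofFinite n L r : GL (Fin n) (AdeleRing (𝓞 L) L)) : Matrix (Fin n) (Fin n) (AdeleRing (𝓞 L) L)) 0 0
      (((gramR L e dV hdV dW hdW).map ((algebraMap L (AdeleRing (𝓞 L) L)).comp (algebraMap (Fp L) L)))⁻¹ *
        ((((GLn.ofFinite n L r)⁻¹ : GL (Fin n) (AdeleRing (𝓞 L) L)) : Matrix (Fin n) (Fin n) (AdeleRing (𝓞 L) L)).map
          (UnitaryGroup.conjAdele (Fp L) L (IsCMField.complexConj L)))ᵀ *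
        (gramR L e dV hdV dW hdW).map ((algebraMap L (AdeleRing (𝓞 L) L)).comp (algebraMap (Fp L) L)))).map f = 1 := by
    rw [Matrix.fromBlocks_map, Matrix.map_zero f hf0, hD, hg, Matrix.fromBlocks_one]
  have hblk : (blk L e dV hdV dW hdW q).map f = 1 := by
    rw [hq, Matrix.map_mul, Matrix.map_mul, hX, Matrix.mul_one, ← Matrix.map_mul, cayR_mul_cayRinv, Matrix.map_one f hf0 hf1]
  -- hence the `GL_{2n}(𝔸_L)`-matrix of `q` has trivial archimedean component
  have hre : ((q : GL (Fin (n + n)) (AdeleRing (𝓞 L) L)) : Matrix (Fin (n + n)) (Fin (n + n)) (AdeleRing (𝓞 L) L)) =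
      Matrix.reindex (e₂ (n := n)) (e₂ (n := n)) (blk L e dV hdV dW hdW q) := by
    show ((q : GL (Fin (n + n)) (AdeleRing (𝓞 L) L)) : Matrix (Fin (n + n)) (Fin (n + n)) (AdeleRing (𝓞 L) L)) =
      Matrix.reindex (e₂ (n := n)) (e₂ (n := n)) (Matrix.reindex (e₂ (n := n)).symm (e₂ (n := n)).symm
        ((q : GL (Fin (n + n)) (AdeleRing (𝓞 L) L)) : Matrix (Fin (n + n)) (Fin (n + n)) (AdeleRing (𝓞 L) L)))
    rw [Matrix.reindex_apply, Matrix.reindex_apply, Matrix.submatrix_submatrix, Equiv.symm_symm, Equiv.self_comp_symm, Matrix.submatrix_id_id]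
  have hmat : ((q : GL (Fin (n + n)) (AdeleRing (𝓞 L) L)) : Matrix (Fin (n + n)) (Fin (n + n)) (AdeleRing (𝓞 L) L)).map f = 1 := by
    rw [hre, Matrix.reindex_apply, ← Matrix.submatrix_map, hblk, Matrix.submatrix_one_equiv]
  have hfst : GLn.fstHom (n + n) L (q : GL (Fin (n + n)) (AdeleRing (𝓞 L) L)) = 1 := by
    refine Matrix.GeneralLinearGroup.ext fun i j => ?_
    have h := congrFun (congrFun hmat i) j
    rw [Matrix.map_apply, hf] at h
    rw [Matrix.GeneralLinearGroup.map_apply, Units.val_one]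
    exact h
  apply Subtype.ext
  rw [UnitaryGroup.coe_archPart, OneMemClass.coe_one, GLn.toMixed_apply, UnitaryGroup.adelicVal_apply]
  change GLn.infiniteEquivMixed (n + n) L (GLn.fstHom (n + n) L (q : GL (Fin (n + n)) (AdeleRing (𝓞 L) L))) = 1
  rw [hfst, map_one]

/-! ## §2 The level letters of I4 ED. 4 over the chart letter `hΛ` -/

/-- **(u-0c) I4 ED. 4 — THE LEVEL LETTERS OVER THE CHART LETTER `hΛ`.**  ★ `exists_level_letters` with its letter `hΛ1 : (Λ(1, r))_∞ = 1` discharged by §1 for a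
Levi homomorphism `Λ` carrying the chart letter `hΛ` of ★ `exists_leviHom` (the consumer's own binder): for a STANDARD datum `𝒦`, a continuous `𝒦.K`-finite `φ`, any Hecke
character `χ`: ONE level `(S, γl)` (`0 ≠ γ_v < 1`) with `hχlev` (`χ(det(1,r)) = 1` on the level), and ONE subgroup `U ≤ H(𝔸)` normalised by `𝒦.K` (`hUK`), fixing `φ` (`hfU`)
and containing `Λ(1, r)` for `r` in the level (`hΛU`). [cite: BorelJacquet1979, §1.1, §4.1] [cite: HarrisKudlaSweet1996, §1 (1.11)] [cite: PlatonovRapinchuk1994, §5.1] -/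
theorem exists_level_letters_of_blk (hdV0 : ∀ i, dV i ≠ 0) (hdW0 : ∀ i, dW i ≠ 0) {𝒦 : IwasawaDatum L e dV hdV dW hdW} (h𝒦 : 𝒦.IsStd)
    (φ : HA L e dV hdV dW hdW → ℂ) (hφ : Literature.NumberTheory.K2Lit.SiegelDoubled.IsKFinite 𝒦 φ) (hφc : Continuous φ) (χ : HeckeCharacter L)
    (Λ : GL (Fin n) (AdeleRing (𝓞 L) L) →* HA L e dV hdV dW hdW)
    (hΛ : ∀ g : GL (Fin n) (AdeleRing (𝓞 L) L), blk L e dV hdV dW hdW (Λ g) =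
      cayR (AdeleRing (𝓞 L) L) (Fin n) * Matrix.fromBlocks (g : Matrix (Fin n) (Fin n) (AdeleRing (𝓞 L) L)) 0 0
        (((gramR L e dV hdV dW hdW).map ((algebraMap L (AdeleRing (𝓞 L) L)).comp (algebraMap (Fp L) L)))⁻¹ *
          (((g⁻¹ : GL (Fin n) (AdeleRing (𝓞 L) L)) : Matrix (Fin n) (Fin n) (AdeleRing (𝓞 L) L)).map
            (UnitaryGroup.conjAdele (Fp L) L (IsCMField.complexConj L)))ᵀ *
          (gramR L e dV hdV dW hdW).map ((algebraMap L (AdeleRing (𝓞 L) L)).comp (algebraMap (Fp L) L))) *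
        cayRinv (AdeleRing (𝓞 L) L) (Fin n))
    (hΛc : Continuous Λ) :
    ∃ (S : Finset (HeightOneSpectrum (𝓞 L))) (γl : ∀ v : HeightOneSpectrum (𝓞 L), ValuativeRel.ValueGroupWithZero (v.adicCompletion L)),
      (∀ v ∈ S, γl v ≠ 0) ∧ (∀ v ∈ S, γl v < 1) ∧
      (∀ r : GL (Fin n) (FiniteAdeleRing (𝓞 L) L), r ∈ glFiniteIntegralLevel n L → (∀ v ∈ S, GLn.evalAt n L v r ∈ congruenceGL n (γl v)) →
        χ (Matrix.GeneralLinearGroup.det (GLn.ofFinite n L r)) = 1) ∧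
      ∃ U : Subgroup (HA L e dV hdV dW hdW),
        (∀ k ∈ 𝒦.K, ∀ u ∈ U, k⁻¹ * u * k ∈ U) ∧
        (∀ (g : HA L e dV hdV dW hdW), ∀ u ∈ U, φ (g * u) = φ g) ∧
        ∀ r : GL (Fin n) (FiniteAdeleRing (𝓞 L) L), r ∈ glFiniteIntegralLevel n L → (∀ v ∈ S, GLn.evalAt n L v r ∈ congruenceGL n (γl v)) →
          Λ (GLn.ofFinite n L r) ∈ U :=
  exists_level_letters h𝒦 φ hφ hφc χ Λ hΛc fun r => archPart_eq_one_of_blk_eq_levi L e dV hdV dW hdW hdV0 hdW0 r (hΛ (GLn.ofFinite n L r))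

end Levi

end Summit.HodgeConjecture.HodgeConjecture.Cruxes.HLiu418.K2LiuSiegelLeviArchPart

end
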